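import Summits.BirchSwinnertonDyer.Rank1Residual.X12.J1728TamagawaThree
import Literature.NumberTheory.EllipticCurves.QuadraticTwistKroneckerLFunctionProofs
import Literature.NumberTheory.EllipticCurves.ComplexMultiplicationLFunctionTableProofs
import Literature.NumberTheory.EllipticCurves.QuadraticTwistJInvariantProofs
import HarnessLib

/-!
# The ramified quadratic twist of a curve of good reduction at an ODD place has Kodaira type `I₀*`
# — the residue characteristic `3` included (Tate's algorithm, Step 6, in the kernel)

HONEST FRAMING (cell `b2b-bsdres`, run/shared/lean/b2b/bsd-rank1-residual/, verbatim in every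
file): the goal of the cell is to DELETE the COMBINATION-SHAPED residual classes of the
Birch–Swinnerton-Dyer formula for ALL analytic-rank `≤ 1` elliptic curves over `ℚ` — "full BSD
formula for every rank `≤ 1` curve in class `C`" assembled STRICTLY from published theorems — so
that the rank-`≤ 1` remainder becomes exactly the CONSTRUCTION-SHAPED classes, which are TYPED
(missing-input `Prop`s), NOT attempted. This is not "finishing BSD". Unit `b2b-bsdres-x1b` (X12
prover owner), generation 22; research route, no claim beyond the stated class; X12 REMAINS
CONSTRUCTION-SHAPED; nothing is booked here — booking is the lane's and the referee's.

Theorems only; no definition, no new named fact.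

The X2 seat's `X2.kodairaSymbolAt_twist_of_dvd` (`X2/TwistKodaira.lean`) gives type `I₀*` for the
twist of a curve of good reduction by a parameter exactly divisible by `ℓ`, for `ℓ ≥ 5` only
(Ogg's formula in the tame case needs residue characteristic `≠ 2, 3`). This file proves it at
EVERY place `v ∤ 2` — `ℓ = 3` included — by Tate's algorithm itself: the twisted equation
`y² = x³ + n(b₂/4)x² + n²(b₄/2)x + n³(b₆/4)` (`WeierstrassCurve.quadraticTwist`) with `ord_v n = 1`
is Step-6 normalised, minimal (`ord_v Δ = 6`), and its Step-6 cubic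
`T³ + w(b₂/4)T² + w²(b₄/2)T + w³(b₆/4)` (`n = π w`, `w ∈ O_vˣ`) has discriminant `w⁶ · Δ(W₀)/16`, a
unit (`kodairaSymbolAt_twist_of_valuation_eq`; Silverman *ATAEC* IV.9.4 Step 6, via the tree's
`kodairaSymbolOfMinimal_eq_Istar_zero_of_step6`).

Consequence (§2) for X12: **for a CM curve whose `j` is one of the nine values
`287496, −3375, 16581375, 8000, −32768, −884736, −884736000, −147197952000, −262537412640768000`
(`d_K ≠ −3`, `j ≠ 1728`), `3 ∤ c_3`**: such a curve is a quadratic twist `E₀^{(n)}`, `n` a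
square-free integer, of a base curve `E₀` with good reduction at `3` (*AEC* X.5.4,
`exists_variableChange_eq_quadraticTwist_of_j_eq'`; `32a3`, `49a1`, `49a2`, `256a1`, `121b1`,
`361a1`, `1849a1`, `4489a1`, `26569a1`), so at the place over `3` it is good (`3 ∤ n`) or of type
`I₀*` (`3 ∥ n`): `c_3 ∈ {1, 2, 4}`. With `J1728TamagawaThree.lean` (`j = 1728`) and
`CMTamagawaThree.lean` (every place `v ∤ 3`): **for EVERY CM curve over `ℚ` with `3 ∤ d_K`,
`3 ∤ ∏_ℓ c_ℓ` — no hypothesis at `3`** (`not_three_dvd_tamagawaProduct_of_hasCM_of_not_cmRamified_three`),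
and the inert-BAD-at-`3` sub-family of X12 (gen 12 `InertBadOddPrime.lean`) loses its Tamagawa datum
for every CM field (§3).

References: [SilvermanATAEC1994] IV.9.4 Step 6, Table 4.1, Cor. IV.9.2; [SilvermanAEC2009] VII.1
Rem. 1.1, X.5 Prop. 5.4; [MatarNekovar2019] Thm. 0.3; [Miller2011LMS] Def. 1.1;
HOME `b2b-bsdres-x1b/X12-ROUTE.md` §26.
-/

noncomputable section

open scoped Classical NumberField

open WeierstrassCurve NumberField IsDedekindDomain IsDedekindDomain.HeightOneSpectrum Field
  Rat.HeightOneSpectrum Literature.NumberTheory.EllipticCurves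
  Literature.NumberTheory.GaloisRepresentations
  Literature.NumberTheory.EllipticCurves.ModularForms
  Literature.NumberTheory.EllipticCurves.Rank1Residual
  Literature.NumberTheory.EllipticCurves.Rank1Residual.Typed
  Literature.NumberTheory.Automorphic
  Literature.NumberTheory.DiophantineGeometry
  Literature.NumberTheory.DiophantineGeometry.TateAlgorithm

namespace Summit.BirchSwinnertonDyer.Rank1Residual.X12

/-! ### §1 Engine: Step 6 of Tate's algorithm on a ramified quadratic twist at an odd place -/

/-- The discriminant of the cubic `T³ + (b₂/4)T² + (b₄/2)T + b₆/4` is `Δ/16`. [cite: SilvermanAEC2009, III.1] -/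
theorem cubicDisc_b_eq_Δ_div {F : Type*} [Field F] [CharZero F] (W : WeierstrassCurve F) :
    (W.b₂ / 4) ^ 2 * (W.b₄ / 2) ^ 2 - 4 * (W.b₄ / 2) ^ 3 - 4 * (W.b₂ / 4) ^ 3 * (W.b₆ / 4)
      - 27 * (W.b₆ / 4) ^ 2 + 18 * (W.b₂ / 4) * (W.b₄ / 2) * (W.b₆ / 4) = W.Δ / 16 := by
  simp only [WeierstrassCurve.Δ, WeierstrassCurve.b₂, WeierstrassCurve.b₄, WeierstrassCurve.b₆,
    WeierstrassCurve.b₈]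
  field_simp
  ring

/-- **A ramified quadratic twist of a curve of good reduction at an odd place has Kodaira type
`I₀*`** — Tate's algorithm, Step 6, at EVERY place `v ∤ 2` (residue characteristic `3` included).
Let `W₀/ℚ` be `v`-integral through its `b`-invariants with `v(Δ(W₀)) = 0`, `n ∈ ℚ` with
`ord_v n = 1`, and `M = W₀^{(n)} = D • W`. Then `M` is minimal at `v` (`ord_v Δ(M) = 6`), Step-6
normalised (`π ∣ a₂`, `π² ∣ a₄`, `π³ ∣ a₆`, `a₁ = a₃ = 0`), and the Step-6 cubic has three distinct
roots in `k̄_v` (discriminant `w⁶ Δ(W₀)/16 ∈ O_vˣ`, `n = πw`): `W.kodairaSymbolAt v = I₀*`.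
[cite: SilvermanATAEC1994, IV.9.4 Step 6 (PDF p. 345) and Table 4.1] [cite: SilvermanAEC2009, VII.1 Remark 1.1] -/
theorem kodairaSymbolAt_twist_of_valuation_eq (W : WeierstrassCurve ℚ) [W.IsElliptic]
    (v : HeightOneSpectrum (𝓞 ℚ)) (hv2 : natGenerator v ≠ 2) (W₀ : WeierstrassCurve ℚ)
    (hb₂ : v.valuation ℚ W₀.b₂ ≤ 1) (hb₄ : v.valuation ℚ W₀.b₄ ≤ 1) (hb₆ : v.valuation ℚ W₀.b₆ ≤ 1)
    (hΔ₀ : v.valuation ℚ W₀.Δ = 1) {n : ℚ} (hn : v.valuation ℚ n = WithZero.exp (-1 : ℤ))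
    (D : VariableChange ℚ) (hM : W₀.quadraticTwist n = D • W) :
    W.kodairaSymbolAt v = .Istar 0 := by
  haveI := perfectField_residueField_adicCompletionIntegers (K := ℚ) v
  set M := W₀.quadraticTwist n with hMdef
  haveI hMell : M.IsElliptic := by rw [hM]; infer_instance
  -- `2` and `4` are `v`-units
  have hp2 : ¬ (natGenerator v : ℤ) ∣ 2 := fun h ↦ hv2 <| by
    have h' : natGenerator v ∣ 2 := by exact_mod_cast h
    exact (Nat.prime_dvd_prime_iff_eq (prime_natGenerator v) Nat.prime_two).mp h'
  have h2 : v.valuation ℚ (2 : ℚ) = 1 := by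
    have := Rat.valuation_intCast_eq_one v hp2; exact_mod_cast this
  have h4 : v.valuation ℚ (4 : ℚ) = 1 := by
    rw [show (4 : ℚ) = 2 ^ 2 by norm_num, map_pow, h2, one_pow]
  have h16 : v.valuation ℚ (16 : ℚ) = 1 := by
    rw [show (16 : ℚ) = 2 ^ 4 by norm_num, map_pow, h2, one_pow]
  have hc2 : ringChar (𝓞 ℚ ⧸ v.asIdeal) ≠ 2 := by
    rw [X2.ringChar_quot_asIdeal_eq_primesEquiv]; exact hv2
  have hexp1 : WithZero.exp (-1 : ℤ) ≤ (1 : WithZero (Multiplicative ℤ)) := by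
    rw [← WithZero.exp_zero, WithZero.exp_le_exp]; omega
  -- valuations of the coefficients of `M`
  have hβ₂ : v.valuation ℚ (W₀.b₂ / 4) ≤ 1 := by rw [map_div₀, h4, div_one]; exact hb₂
  have hβ₄ : v.valuation ℚ (W₀.b₄ / 2) ≤ 1 := by rw [map_div₀, h2, div_one]; exact hb₄
  have hβ₆ : v.valuation ℚ (W₀.b₆ / 4) ≤ 1 := by rw [map_div₀, h4, div_one]; exact hb₆
  have e₂ : M.a₂ = n * (W₀.b₂ / 4) := by rw [hMdef, quadraticTwist_a₂]; ring
  have e₄ : M.a₄ = n ^ 2 * (W₀.b₄ / 2) := by rw [hMdef, quadraticTwist_a₄]; ring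
  have e₆ : M.a₆ = n ^ 3 * (W₀.b₆ / 4) := by rw [hMdef, quadraticTwist_a₆]; ring
  have hva₂ : v.valuation ℚ M.a₂ ≤ WithZero.exp (-1 : ℤ) := by
    rw [e₂, map_mul, hn]; exact mul_le_of_le_one_right' hβ₂
  have hva₄ : v.valuation ℚ M.a₄ ≤ WithZero.exp (-2 : ℤ) := by
    rw [e₄, map_mul, map_pow, hn, ← WithZero.exp_nsmul]
    exact (mul_le_of_le_one_right' hβ₄).trans (by simp)
  have hva₆ : v.valuation ℚ M.a₆ ≤ WithZero.exp (-3 : ℤ) := by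
    rw [e₆, map_mul, map_pow, hn, ← WithZero.exp_nsmul]
    exact (mul_le_of_le_one_right' hβ₆).trans (by simp)
  -- integrality and minimality of `X = M ⊗ ℚ_v`
  have hint : M.IsIntegralAt v :=
    M.isIntegralAt_of_valuation_le_one v (by rw [hMdef, quadraticTwist_a₁, map_zero]; exact zero_le_one)
      (hva₂.trans hexp1) (by rw [hMdef, quadraticTwist_a₃, map_zero]; exact zero_le_one)
      (hva₄.trans (by rw [← WithZero.exp_zero, WithZero.exp_le_exp]; omega))
      (hva₆.trans (by rw [← WithZero.exp_zero, WithZero.exp_le_exp]; omega))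
  have hΔ : v.valuation ℚ M.Δ = WithZero.exp (-((6 : ℕ) : ℤ)) := by
    rw [hMdef, quadraticTwist_Δ, map_mul, map_pow, hn, hΔ₀, mul_one, ← WithZero.exp_nsmul]
    simp
  have hmin : M.IsMinimalAt v :=
    isMinimalAt_of_lt_valuation_Δ_holds hint (by rw [hΔ]; exact WithZero.exp_lt_exp.mpr (by omega))
  set X := M.baseChange (v.adicCompletion ℚ) with hX
  haveI hXint : X.IsIntegral (v.adicCompletionIntegers ℚ) := hint
  haveI hXmin : X.IsMinimal (v.adicCompletionIntegers ℚ) := hmin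
  haveI hXell : X.IsElliptic := by rw [hX, WeierstrassCurve.baseChange]; infer_instance
  set I := X.integralModel (v.adicCompletionIntegers ℚ) with hI
  -- the coefficients of the `O_v`-model in `ℚ_v`
  have hIK : ∀ {x : v.adicCompletionIntegers ℚ} {q : ℚ},
      algebraMap (v.adicCompletionIntegers ℚ) (v.adicCompletion ℚ) x = algebraMap ℚ (v.adicCompletion ℚ) q →
      (x : v.adicCompletion ℚ) = algebraMap ℚ (v.adicCompletion ℚ) q := fun h ↦ h
  have cIa₁ : ((I.a₁ : v.adicCompletionIntegers ℚ) : v.adicCompletion ℚ) = algebraMap ℚ _ M.a₁ :=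
    hIK (by rw [hI, integralModel_a₁_eq, hX, WeierstrassCurve.baseChange, map_a₁])
  have cIa₂ : ((I.a₂ : v.adicCompletionIntegers ℚ) : v.adicCompletion ℚ) = algebraMap ℚ _ M.a₂ :=
    hIK (by rw [hI, integralModel_a₂_eq, hX, WeierstrassCurve.baseChange, map_a₂])
  have cIa₃ : ((I.a₃ : v.adicCompletionIntegers ℚ) : v.adicCompletion ℚ) = algebraMap ℚ _ M.a₃ :=
    hIK (by rw [hI, integralModel_a₃_eq, hX, WeierstrassCurve.baseChange, map_a₃])
  have cIa₄ : ((I.a₄ : v.adicCompletionIntegers ℚ) : v.adicCompletion ℚ) = algebraMap ℚ _ M.a₄ :=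
    hIK (by rw [hI, integralModel_a₄_eq, hX, WeierstrassCurve.baseChange, map_a₄])
  have cIa₆ : ((I.a₆ : v.adicCompletionIntegers ℚ) : v.adicCompletion ℚ) = algebraMap ℚ _ M.a₆ :=
    hIK (by rw [hI, integralModel_a₆_eq, hX, WeierstrassCurve.baseChange, map_a₆])
  -- the unit `w` with `n = π w`, and the integral elements `β₂, β₄, β₆, δ`
  set ϖ := uniformizer (v.adicCompletionIntegers ℚ) with hϖ
  have vK : ∀ q : ℚ, Valued.v (algebraMap ℚ (v.adicCompletion ℚ) q) = v.valuation ℚ q :=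
    fun q ↦ WeierstrassCurve.valued_algebraMap_adicCompletion v q
  have mem_of_le : ∀ q : ℚ, v.valuation ℚ q ≤ 1 →
      algebraMap ℚ (v.adicCompletion ℚ) q ∈ v.adicCompletionIntegers ℚ := fun q hq ↦ by
    rw [HeightOneSpectrum.mem_adicCompletionIntegers, vK]; exact hq
  have hn1 : v.valuation ℚ n ≤ 1 := by rw [hn]; exact hexp1
  have hδ1 : v.valuation ℚ (W₀.Δ / 16) ≤ 1 := by rw [map_div₀, hΔ₀, h16, div_one]
  set nO : v.adicCompletionIntegers ℚ := ⟨algebraMap ℚ (v.adicCompletion ℚ) n, mem_of_le n hn1⟩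
    with hnO
  have cnO : ((nO : v.adicCompletionIntegers ℚ) : v.adicCompletion ℚ) = algebraMap ℚ _ n := rfl
  have hnOv : Valued.v ((nO : v.adicCompletionIntegers ℚ) : v.adicCompletion ℚ) =
      WithZero.exp (-((1 : ℕ) : ℤ)) := by rw [cnO, vK, hn]; norm_num
  obtain ⟨w, hw, hnw⟩ := exists_isUnit_eq_uniformizer_pow_mul_of_valued_eq v hnOv
  set β₂ : v.adicCompletionIntegers ℚ := ⟨algebraMap ℚ (v.adicCompletion ℚ) (W₀.b₂ / 4), mem_of_le _ hβ₂⟩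
    with hβ₂def
  set β₄ : v.adicCompletionIntegers ℚ := ⟨algebraMap ℚ (v.adicCompletion ℚ) (W₀.b₄ / 2), mem_of_le _ hβ₄⟩
    with hβ₄def
  set β₆ : v.adicCompletionIntegers ℚ := ⟨algebraMap ℚ (v.adicCompletion ℚ) (W₀.b₆ / 4), mem_of_le _ hβ₆⟩
    with hβ₆def
  set δ : v.adicCompletionIntegers ℚ := ⟨algebraMap ℚ (v.adicCompletion ℚ) (W₀.Δ / 16), mem_of_le _ hδ1⟩
    with hδdef
  have cβ₂ : ((β₂ : v.adicCompletionIntegers ℚ) : v.adicCompletion ℚ) = algebraMap ℚ _ (W₀.b₂ / 4) := rfl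
  have cβ₄ : ((β₄ : v.adicCompletionIntegers ℚ) : v.adicCompletion ℚ) = algebraMap ℚ _ (W₀.b₄ / 2) := rfl
  have cβ₆ : ((β₆ : v.adicCompletionIntegers ℚ) : v.adicCompletion ℚ) = algebraMap ℚ _ (W₀.b₆ / 4) := rfl
  have cδ : ((δ : v.adicCompletionIntegers ℚ) : v.adicCompletion ℚ) = algebraMap ℚ _ (W₀.Δ / 16) := rfl
  have hδu : IsUnit δ := by
    rw [adicCompletionIntegers.isUnit_iff_valued_eq_one]
    rw [cδ, vK, map_div₀, hΔ₀, h16, div_one]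
  -- `I.a₂ = π (w β₂)`, `I.a₄ = π² (w² β₄)`, `I.a₆ = π³ (w³ β₆)`
  have hI₂ : I.a₂ = ϖ ^ 1 * (w * β₂) := by
    apply Subtype.ext
    have h := cIa₂
    rw [e₂, map_mul, ← cnO, ← cβ₂, hnw] at h
    rw [h]; push_cast; ring
  have hI₄ : I.a₄ = ϖ ^ 2 * (w ^ 2 * β₄) := by
    apply Subtype.ext
    have h := cIa₄
    rw [e₄, map_mul, map_pow, ← cnO, ← cβ₄, hnw] at h
    rw [h]; push_cast; ring
  have hI₆ : I.a₆ = ϖ ^ 3 * (w ^ 3 * β₆) := by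
    apply Subtype.ext
    have h := cIa₆
    rw [e₆, map_mul, map_pow, ← cnO, ← cβ₆, hnw] at h
    rw [h]; push_cast; ring
  -- the Step-6 cubic has three distinct roots
  have cnum : ∀ k : ℕ, ((OfNat.ofNat (k + 2) : v.adicCompletionIntegers ℚ) : v.adicCompletion ℚ) =
      (OfNat.ofNat (k + 2) : v.adicCompletion ℚ) := fun k ↦
    map_ofNat (algebraMap (v.adicCompletionIntegers ℚ) (v.adicCompletion ℚ)) (k + 2)
  have hdiscβ : β₂ ^ 2 * β₄ ^ 2 - 4 * β₄ ^ 3 - 4 * β₂ ^ 3 * β₆ - 27 * β₆ ^ 2 + 18 * β₂ * β₄ * β₆ = δ := by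
    apply Subtype.ext
    push_cast
    rw [cnum 2, cnum 16, cnum 25, cβ₂, cβ₄, cβ₆, cδ, ← cubicDisc_b_eq_Δ_div W₀]
    simp only [map_sub, map_add, map_mul, map_pow, map_div₀, map_ofNat]
  have h6 : distinctRootCount (cubicStep6 I) = 3 := by
    rw [cubicStep6, hI₂, hI₄, hI₆, redCoeff_uniformizer_pow_mul, redCoeff_uniformizer_pow_mul,
      redCoeff_uniformizer_pow_mul, distinctRootCount_cubic_eq_three_iff]
    have hE : (w * β₂) ^ 2 * (w ^ 2 * β₄) ^ 2 - 4 * (w ^ 2 * β₄) ^ 3 - 4 * (w * β₂) ^ 3 * (w ^ 3 * β₆)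
        - 27 * (w ^ 3 * β₆) ^ 2 + 18 * (w * β₂) * (w ^ 2 * β₄) * (w ^ 3 * β₆) = w ^ 6 * δ := by
      rw [← hdiscβ]; ring
    have hres : IsLocalRing.residue (v.adicCompletionIntegers ℚ) (w ^ 6 * δ) ≠ 0 :=
      (isUnit_iff_residue_ne_zero _).mp ((hw.pow 6).mul hδu)
    intro h0
    apply hres
    rw [← hE]
    simp only [map_sub, map_add, map_mul, map_pow, map_ofNat]
    exact h0
  -- divisibilities and Tate's algorithm
  have dvdk : ∀ {x : v.adicCompletionIntegers ℚ} (k : ℕ),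
      Valued.v (x : v.adicCompletion ℚ) ≤ WithZero.exp (-(k : ℤ)) → ϖ ^ k ∣ x := fun {x} k hx ↦
    uniformizer_pow_dvd_of_valued_le v (x := x) (n := k) hx
  have q1 : ϖ ∣ I.a₁ := by
    have := dvdk (x := I.a₁) 1 (by rw [cIa₁, vK, hMdef, quadraticTwist_a₁, map_zero]; exact zero_le)
    rwa [pow_one] at this
  have q2 : ϖ ∣ I.a₂ := ⟨w * β₂, by rw [hI₂, pow_one]⟩
  have q3 : ϖ ^ 2 ∣ I.a₃ :=
    dvdk (x := I.a₃) 2 (by rw [cIa₃, vK, hMdef, quadraticTwist_a₃, map_zero]; exact zero_le)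
  have q4 : ϖ ^ 2 ∣ I.a₄ := ⟨w ^ 2 * β₄, hI₄⟩
  have q6 : ϖ ^ 3 ∣ I.a₆ := ⟨w ^ 3 * β₆, hI₆⟩
  have hK : I.kodairaSymbolOfMinimal = .Istar 0 :=
    kodairaSymbolOfMinimal_eq_Istar_zero_of_step6 q1 q2 q3 q4 q6 h6
  have hrel : X = (D.map (algebraMap ℚ (v.adicCompletion ℚ))) • W.baseChange (v.adicCompletion ℚ) := by
    rw [hX, hM, WeierstrassCurve.baseChange, WeierstrassCurve.baseChange, map_variableChange]
  rw [W.kodairaSymbolAt_eq_kodairaSymbolOfMinimal_of_isMinimal v X _ hrel X.isUnit_Δ.ne_zero, ← hI, hK]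

/-! ### §2 The place `3` of a CM curve with `j ∉ {0, 1728, 54000, −12288000}` -/

/-- **`3 ∤ c_3` for every curve with the `j`-invariant of an integral model `E₀ = [a₁,…,a₆]` with
`3 ∤ Δ(E₀)`, `j ≠ 0, 1728`.** Such a curve is `E₀^{(d)}` (*AEC* X.5.4,
`exists_variableChange_eq_quadraticTwist_of_j_eq'`); writing `d = c²n` with `n` a square-free integer
(`Rat.exists_sq_mul_squarefree`, `quadraticTwist_sq_mul`), at the place over `3` the twist `E₀^{(n)}`
is good (`3 ∤ n`: unit discriminant) or of type `I₀*` (`3 ∥ n`: `kodairaSymbolAt_twist_of_valuation_eq`),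
so `c_3 ∣ #Φ(k̄) ∈ {1, 4}` is prime to `3`. [cite: SilvermanATAEC1994, IV.9.4 Step 6, Table 4.1 and Cor. IV.9.2]
[cite: SilvermanAEC2009, X.5 Prop. 5.4] -/
theorem not_three_dvd_localTamagawaNumber_three_of_j_eq_twist (W : WeierstrassCurve ℚ) [W.IsElliptic]
    (v : HeightOneSpectrum (𝓞 ℚ)) (hv : natGenerator v = 3) (a1 a2 a3 a4 a6 : ℤ)
    [hE : (⟨(a1 : ℚ), (a2 : ℚ), (a3 : ℚ), (a4 : ℚ), (a6 : ℚ)⟩ : WeierstrassCurve ℚ).IsElliptic]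
    {Dz : ℤ} (hΔ : (⟨(a1 : ℚ), (a2 : ℚ), (a3 : ℚ), (a4 : ℚ), (a6 : ℚ)⟩ : WeierstrassCurve ℚ).Δ = Dz)
    (hD3 : ¬ (3 : ℤ) ∣ Dz)
    (hj : W.j = (⟨(a1 : ℚ), (a2 : ℚ), (a3 : ℚ), (a4 : ℚ), (a6 : ℚ)⟩ : WeierstrassCurve ℚ).j)
    (h0 : W.j ≠ 0) (h1728 : W.j ≠ 1728) :
    ¬ 3 ∣ (W.baseChange (v.adicCompletion ℚ)).localTamagawaNumber (v.adicCompletionIntegers ℚ) := by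
  haveI : Finite (IsLocalRing.ResidueField (v.adicCompletionIntegers ℚ)) :=
    HeightOneSpectrum.finite_residueField_adicCompletionIntegers ℚ v
  haveI : PerfectField (IsLocalRing.ResidueField (v.adicCompletionIntegers ℚ)) :=
    PerfectField.ofFinite
  set E₀ : WeierstrassCurve ℚ := ⟨(a1 : ℚ), (a2 : ℚ), (a3 : ℚ), (a4 : ℚ), (a6 : ℚ)⟩ with hE₀
  have hv2 : natGenerator v ≠ 2 := by rw [hv]; decide
  -- integrality of `E₀` at `v` and `v(Δ(E₀)) = 1`
  have hb₂ : v.valuation ℚ E₀.b₂ ≤ 1 := by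
    rw [show E₀.b₂ = ((a1 * a1 + 4 * a2 : ℤ) : ℚ) by rw [hE₀]; simp only [WeierstrassCurve.b₂]; push_cast; ring]
    exact valuation_ringOfIntegers_intCast_le_one v _
  have hb₄ : v.valuation ℚ E₀.b₄ ≤ 1 := by
    rw [show E₀.b₄ = ((2 * a4 + a1 * a3 : ℤ) : ℚ) by rw [hE₀]; simp only [WeierstrassCurve.b₄]; push_cast; ring]
    exact valuation_ringOfIntegers_intCast_le_one v _
  have hb₆ : v.valuation ℚ E₀.b₆ ≤ 1 := by
    rw [show E₀.b₆ = ((a3 * a3 + 4 * a6 : ℤ) : ℚ) by rw [hE₀]; simp only [WeierstrassCurve.b₆]; push_cast; ring]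
    exact valuation_ringOfIntegers_intCast_le_one v _
  have hΔ₀ : v.valuation ℚ E₀.Δ = 1 := by
    rw [hΔ]; exact Rat.valuation_intCast_eq_one v (by rw [hv]; exact_mod_cast hD3)
  -- the twist normal form with square-free parameter
  obtain ⟨d, hd0, C, hC⟩ := exists_variableChange_eq_quadraticTwist_of_j_eq' (E := E₀) hj h0 h1728
  obtain ⟨c, n, hc, hsq, hdn⟩ := Rat.exists_sq_mul_squarefree hd0
  have hn0 : n ≠ 0 := by rintro rfl; simp at hdn; exact hd0 hdn
  set T : VariableChange ℚ := ⟨(Units.mk0 c hc)⁻¹, 0, 0, 0⟩ with hT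
  have hM : E₀.quadraticTwist (n : ℚ) = (T⁻¹ * C) • W := by
    rw [mul_smul, hC, hdn, quadraticTwist_sq_mul E₀ hc, ← hT, inv_smul_smul]
  intro hdvd
  have hcgo : 3 ∣ (W.kodairaSymbolAt v).componentGroupOrder :=
    hdvd.trans (localTamagawaNumber_dvd_componentGroupOrder v W (nonempty_neronComponentData_holds W v))
  by_cases h3n : (3 : ℤ) ∣ n
  · -- `3 ∥ n`: type `I₀*`
    have h9n : ¬ (3 : ℤ) ^ 2 ∣ n := fun h9 ↦ by
      have := hsq 3 (by simpa [sq] using h9)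
      rw [Int.isUnit_iff] at this; omega
    have hpv : ((primesEquiv v : ℕ) : ℤ) = 3 := by
      rw [show (primesEquiv v : ℕ) = natGenerator v from rfl, hv]; rfl
    have hnv : v.valuation ℚ (n : ℚ) = WithZero.exp (-1 : ℤ) :=
      valuation_ringOfIntegers_intCast_eq_exp_neg_one v (by rw [hpv]; exact h3n) (by rw [hpv]; exact h9n)
    have hT0 := kodairaSymbolAt_twist_of_valuation_eq W v hv2 E₀ hb₂ hb₄ hb₆ hΔ₀ hnv _ hM
    rw [hT0] at hcgo
    simp [KodairaSymbol.componentGroupOrder] at hcgo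
  · -- `3 ∤ n`: good reduction at `v`
    have hnv : v.valuation ℚ (n : ℚ) = 1 :=
      Rat.valuation_intCast_eq_one v (by rw [hv]; exact_mod_cast h3n)
    have h2 : v.valuation ℚ (2 : ℚ) = 1 := by
      have := Rat.valuation_intCast_eq_one v (n := 2) (by rw [hv]; decide); exact_mod_cast this
    have h4 : v.valuation ℚ (4 : ℚ) = 1 := by
      rw [show (4 : ℚ) = 2 ^ 2 by norm_num, map_pow, h2, one_pow]
    set M := E₀.quadraticTwist (n : ℚ) with hMdef
    haveI : M.IsElliptic := by rw [hM]; infer_instance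
    have hint : M.IsIntegralAt v := by
      refine M.isIntegralAt_of_valuation_le_one v (by simp [hMdef, quadraticTwist_a₁]) ?_
        (by simp [hMdef, quadraticTwist_a₃]) ?_ ?_
      · rw [hMdef, quadraticTwist_a₂, map_div₀, map_mul, hnv, h4, one_mul, div_one]; exact hb₂
      · rw [hMdef, quadraticTwist_a₄, map_div₀, map_mul, map_pow, hnv, h2, one_pow, one_mul, div_one]
        exact hb₄
      · rw [hMdef, quadraticTwist_a₆, map_div₀, map_mul, map_pow, hnv, h4, one_pow, one_mul, div_one]
        exact hb₆
    have hΔ1 : v.valuation ℚ M.Δ = 1 := by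
      rw [hMdef, quadraticTwist_Δ, map_mul, map_pow, hnv, one_pow, one_mul, hΔ₀]
    have hmin : M.IsMinimalAt v := isMinimalAt_of_lt_valuation_Δ_holds hint
      (by rw [hΔ1, ← WithZero.exp_zero]; exact WithZero.exp_lt_exp.mpr (by norm_num))
    have hgoodM : M.HasGoodReductionAt v :=
      (hasGoodReductionAt_iff_of_isMinimalAt (v := v) (W := M) hmin).mpr hΔ1
    have hgood : W.HasGoodReductionAt v := by
      rw [hM] at hgoodM; exact (hasGoodReductionAt_smul_iff_holds v W _).mp hgoodM
    rcases kodairaSymbol_of_three_dvd_componentGroupOrder hcgo with ⟨m, hm, hk⟩ | hk | hk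
    · exact hgood.not_hasMultiplicativeReductionAt ((kodairaSymbolAt_eq_I_iff_holds v W hm).mp hk).1
    · exact hgood.not_hasAdditiveReductionAt
        ((isAdditive_kodairaSymbolAt_iff_holds v W).mp (hk ▸ by decide))
    · exact hgood.not_hasAdditiveReductionAt
        ((isAdditive_kodairaSymbolAt_iff_holds v W).mp (hk ▸ by decide))

end Summit.BirchSwinnertonDyer.Rank1Residual.X12

end
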